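import Summits.Ventures.HSemireg.WedgeHankelRecurrenceHurwitzMatrix

/-!
# Venture HSemireg — THE HURWITZ DETERMINANTS ARE THE LEADING PRINCIPAL MINORS OF THE TWO BEZOUTIANS (regular case, any field): for `p = f(X²) + X·g(X²)` with ascending Hurwitz determinants
# `Δ_k = det H_k(p_0, p_1, …)` all non-zero up to the relevant order, **`det B_j(g, f) = Δ_{2j}`** and **`det B_j(f, X·g) = p_0 · Δ_{2j−1}`** — the bridge between Gantmacher's Hurwitz matrix
# (Ch. XV §6) and the Bezoutian ∕ Hankel forms of Hermite–Fujiwara–Liénard–Chipart (F–H Thm 5.55 (iii), BPR Thm 9.30), by a simultaneous induction on `j` along Routh's step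

HONEST FRAMING. Part of the Lean index of the computation cell `pub-hsemireg` (seat p10 gen 39, Sunday typer «UNIFORM-IN-n»).
DETERMINANTS OF BEZOUTIANS AND COEFFICIENT MATRICES ONLY (PROVED Literature `LinearAlgebra/Matrix/Bezoutian` IMPORTED; Mathlib `Matrix.det`): no variety, no cohomology theory, no sheaf, no
Ext group and no semiregularity map is constructed here; nothing here says that HC / HC_CM / HC_AV holds; no Literature fact (unproved `Prop`) is declared or used.  Custodian versions as in
`WedgeHankelSiegelIdeal` (1/3).
SOURCES (cited).  F. R. Gantmacher, *The Theory of Matrices* Ch. XV §6 (27)–(33) (Hurwitz matrix, `Δ_{k+1} = b_0 · Δ̃_k` along Routh's scheme; held `book:gantmacher1984-theory-matrices` p0163–p0167);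
P. A. Fuhrmann, U. Helmke (2015) Thm 5.55 (iii) and S. Basu, R. Pollack, M.-F. Roy (2006) Thm 9.30 (Hurwitz ⟺ the two Bezoutian ∕ Hankel forms of the even and odd parts are positive definite
— typed N189 ∕ N201); O. Holtz, LAA 372 (2003) Thm 2 (Routh's step as the bordering `B(f, Xg) = c·vvᵀ + (0 ⊕ B(g₁, g))`, `f = c g + X g₁` — typed N202 over `ℝ`).  The identification
«Hurwitz determinants = principal minors of the Bezoutian (Hermite) matrix of the even∕odd parts» is classical (Hermite 1856 ∕ Hurwitz 1895 ∕ Fujiwara 1915; cf. Lancaster–Tismenetsky,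
*The Theory of Matrices* (1985) §13.8–13.9); HERE it is DERIVED, in the ascending (constant-term) reading of this lineage, from the two recursions along Routh's step:
`det B_j(f, Xg) = c·g₀²·det B_{j−1}(g₁, g)` (bordering; `c = f₀/g₀`), `B(g, f) = B(g, X g₁)` (alternation), and `Δ_{k+1}(p) = g₀ · Δ_k(p̃)` (N210), by induction on `j` for all pairs at once.
DEDUP DISCLOSURE (`rg -i 'bezoutian.*hurwitz|hurwitzSeqMatrix.*bezoutian'`, 2026-09-02): N189 ∕ N201 have the Bezoutian criteria, N210 ∕ N211 the Hurwitz matrices; no minor dictionary in the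
tree or Mathlib.  N202's bordering lemmas are over `ℝ`; the general-field forms below are new statements (any field).  The 10 names below: 0 hits tree-wide.

WHAT IS IN THE TREE.  N210: `hurwitzSeqMatrix`, `det_hurwitzSeqMatrix_succ_eq_mul` (any commutative ring), `det_hurwitzSeqMatrix_one`; N202 (over `ℝ`, re-derived here over any field):
`bezoutian_self_X_mul`, `bezCoeff_X_mul_X_mul_zero_left ∕ _zero_right ∕ _succ_succ`, `bezoutian_routh_right`; Literature `Bezoutian`: `bezoutian_apply`, `bezoutian_add_left ∕ _right`,
`bezoutian_smul_left ∕ _right`, `bezoutian_self`, `bezCoeff_X_mul_left_zero ∕ _succ`, `bezCoeff_swap`, `bezCoeff_comm`, `bezCoeff_self`.  Mathlib: `Matrix.det_eq_of_forall_row_eq_smul_add_const`,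
`Matrix.det_succ_column_zero`, `Polynomial.coeff_expand_mul`, `Polynomial.coeff_expand`, `Polynomial.divX`.
THIS FILE (namespace `Summit.Ventures.HSemireg.Wedge.HankelOuter` continued; CHAINED on N210; 0 definitions):
* §937 GENERAL-FIELD BOOKKEEPING: `coeff_expand_two_add_X_mul_even ∕ _odd` (`(f(X²) + Xg(X²))_{2k} = f_k`, `_{2k+1} = g_k`, any field), `submatrix_bezoutian_castLE` (leading blocks of a
  Bezoutian are Bezoutians), `eq_C_mul_add_X_mul_divX_field` (`f = (f₀/g₀)g + X·g₁`), **`det_bezoutian_X_mul_succ`** (`det B_{j+1}(f, Xg) = c·g₀²·det B_j(g₁, g)`, field, `g₀ ≠ 0`; from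
  `B(f, Xg) = c·vvᵀ + (0 ⊕ B(g₁, g))`), `coeff_routh_transform_field`, `det_hurwitzSeqMatrix_succ_eq_mul_routh` (N210's (33)-step over any field: `Δ_{k+1}(p) = g₀ Δ_k(p̃)`).
* §938 THE DICTIONARY: **`det_bezoutian_eq_det_hurwitzSeqMatrix`** (regular to order `2j`: `det B_j(g, f) = Δ_{2j}(p)` AND `det B_j(f, Xg) = p_0 · Δ_{2j−1}(p)`), and the two projections
  `det_bezoutian_even_odd_eq` ∕ `det_bezoutian_X_mul_eq`.
CAVEATS.  Regular case only: the `Δ_k ≠ 0` hypotheses make every Routh step divide by `g₀ ≠ 0`; the identities are polynomial and hold without them (generic-point argument), but that extension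
is not typed here.  Nothing Ext-side.  New names only.
-/

open Module Polynomial
open scoped Matrix Polynomial

namespace Summit.Ventures.HSemireg.Wedge.HankelOuter

open Summit.Ventures.HSemireg.Wedge Summit.Ventures.HSemireg.Wedge.Hankel
open Literature.LinearAlgebra.Matrix.Bezoutian (bezCoeff bezoutian bezoutian_apply bezoutian_add_left bezoutian_add_right bezoutian_smul_left bezoutian_smul_right bezoutian_self
  bezCoeff_X_mul_left_zero bezCoeff_X_mul_left_succ bezCoeff_swap bezCoeff_comm bezCoeff_self)

/-! ## §937. General-field bookkeeping for Routh's step -/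

section General

variable {K : Type*} [Field K]

/-- `(f(X²) + X g(X²))_{2k} = f_k` over any field (N201 is the real instance). [bookkeeping; this file, §937] -/
theorem coeff_expand_two_add_X_mul_even (f g : K[X]) (k : ℕ) : (expand K 2 f + Polynomial.X * expand K 2 g).coeff (2 * k) = f.coeff k := by
  rw [coeff_add, mul_comm 2 k, coeff_expand_mul two_pos]
  rcases k with _ | k
  · rw [Nat.zero_mul, coeff_X_mul_zero, add_zero]
  · rw [show (k + 1) * 2 = (2 * k + 1) + 1 by ring, coeff_X_mul, coeff_expand two_pos, if_neg (by omega), add_zero]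

/-- `(f(X²) + X g(X²))_{2k+1} = g_k` over any field. [bookkeeping; this file, §937] -/
theorem coeff_expand_two_add_X_mul_odd (f g : K[X]) (k : ℕ) : (expand K 2 f + Polynomial.X * expand K 2 g).coeff (2 * k + 1) = g.coeff k := by
  rw [coeff_add, coeff_X_mul, coeff_expand two_pos, if_neg (by omega), zero_add, mul_comm 2 k, coeff_expand_mul two_pos]

/-- **Leading blocks of a Bezoutian are Bezoutians** (the array `b_{ij}` does not depend on the truncation order). [bookkeeping; this file, §937] -/
theorem submatrix_bezoutian_castLE {j n : ℕ} (h : j ≤ n) (a b : K[X]) : (bezoutian n a b).submatrix (Fin.castLE h) (Fin.castLE h) = bezoutian j a b := by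
  ext i l
  rw [Matrix.submatrix_apply, bezoutian_apply, bezoutian_apply, Fin.val_castLE, Fin.val_castLE]

/-- `f = (f₀/g₀)·g + X·((f − C(f₀/g₀) g)/X)` when `g₀ ≠ 0` (N202 over `ℝ`). [bookkeeping; this file, §937] -/
theorem eq_C_mul_add_X_mul_divX_field {f g : K[X]} (hg0 : g.coeff 0 ≠ 0) : f = C (f.coeff 0 / g.coeff 0) * g + Polynomial.X * (f - C (f.coeff 0 / g.coeff 0) * g).divX := by
  have h := X_mul_divX_add (f - C (f.coeff 0 / g.coeff 0) * g)
  have h0 : (f - C (f.coeff 0 / g.coeff 0) * g).coeff 0 = 0 := by rw [coeff_sub, coeff_C_mul, div_mul_cancel₀ _ hg0, sub_self]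
  rw [h0, map_zero, add_zero] at h
  rw [h, add_sub_cancel]

/-- **Holtz's bordering as a DETERMINANT identity over any field: `det B_{j+1}(f, X·g) = c·g₀²·det B_j(g₁, g)` for `f = c·g + X·g₁`, `g₀ ≠ 0`** (`B(f, Xg) = c·vvᵀ + (0 ⊕ B(g₁, g))`, `v = (g_i)`;
subtract `(g_i/g₀)×` row `0` from row `i`, then Laplace along column `0`). [Holtz 2003 Thm 2; this file, §937] -/
theorem det_bezoutian_X_mul_succ (j : ℕ) {f g g₁ : K[X]} {c : K} (hf : f = C c * g + Polynomial.X * g₁) (hg0 : g.coeff 0 ≠ 0) :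
    (bezoutian (j + 1) f (Polynomial.X * g)).det = c * g.coeff 0 ^ 2 * (bezoutian j g₁ g).det := by
  have hB : bezoutian (j + 1) f (Polynomial.X * g) = c • Matrix.vecMulVec (fun i : Fin (j + 1) => g.coeff i) (fun l : Fin (j + 1) => g.coeff l) + bezoutian (j + 1) (Polynomial.X * g₁) (Polynomial.X * g) := by
    rw [hf, bezoutian_add_left, ← smul_eq_C_mul, bezoutian_smul_left, bezoutian_self_X_mul]
  -- the row-reduced matrix: row 0 = `c g₀ v`, rows `i ≥ 1` = `(0 | B(g₁, g))`
  set B' : Matrix (Fin (j + 1)) (Fin (j + 1)) K := Matrix.of fun i l => if (i : ℕ) = 0 then c * (g.coeff 0 * g.coeff l) else bezoutian (j + 1) (Polynomial.X * g₁) (Polynomial.X * g) i l with hB'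
  have hdet : (bezoutian (j + 1) f (Polynomial.X * g)).det = B'.det := by
    refine Matrix.det_eq_of_forall_row_eq_smul_add_const (fun i : Fin (j + 1) => if (i : ℕ) = 0 then 0 else g.coeff i / g.coeff 0) 0 (by simp) fun i l => ?_
    rw [hB, Matrix.add_apply, Matrix.smul_apply, Matrix.vecMulVec_apply, smul_eq_mul]
    rcases Fin.eq_zero_or_eq_succ i with rfl | ⟨i, rfl⟩
    · simp only [hB', Matrix.of_apply, Fin.val_zero, ↓reduceIte, zero_mul, add_zero, bezoutian_apply, bezCoeff_X_mul_X_mul_zero_left]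
    · simp only [hB', Matrix.of_apply, Fin.val_zero, Fin.val_succ, Nat.succ_ne_zero, ↓reduceIte]
      field_simp
      ring
  rw [hdet, Matrix.det_succ_column_zero, Fin.sum_univ_succ]
  have hcol : ∀ i : Fin j, B' i.succ 0 = 0 := fun i => by
    rw [hB', Matrix.of_apply, Fin.val_succ, if_neg (Nat.succ_ne_zero _), bezoutian_apply, Fin.val_zero, bezCoeff_X_mul_X_mul_zero_right]
  simp only [hcol, mul_zero, zero_mul, Finset.sum_const_zero, add_zero, Fin.val_zero, pow_zero, one_mul, Fin.succAbove_zero]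
  have h00 : B' 0 0 = c * g.coeff 0 ^ 2 := by
    simp only [hB', Matrix.of_apply, Fin.val_zero, ↓reduceIte]
    ring
  have hmin : B'.submatrix Fin.succ Fin.succ = bezoutian j g₁ g := by
    ext i l
    rw [Matrix.submatrix_apply, hB', Matrix.of_apply, Fin.val_succ, if_neg (Nat.succ_ne_zero _), bezoutian_apply, bezoutian_apply, Fin.val_succ, Fin.val_succ, bezCoeff_X_mul_X_mul_succ_succ]
  rw [h00, hmin]

/-- The coefficient sequence of the Routh transform over any field: `p̃_m = p_{m+1} − [m odd]·γ·p_{m+2}` for `p̃ = g(X²) + X·((f − C γ g)/X)(X²)` (N210 §910 over `ℝ`). [this file, §937] -/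
theorem coeff_routh_transform_field (f g : K[X]) (γ : K) (m : ℕ) :
    (expand K 2 g + Polynomial.X * expand K 2 (f - C γ * g).divX).coeff m
      = (expand K 2 f + Polynomial.X * expand K 2 g).coeff (m + 1) - if m % 2 = 1 then γ * (expand K 2 f + Polynomial.X * expand K 2 g).coeff (m + 2) else 0 := by
  obtain ⟨r, hr | hr⟩ := Nat.even_or_odd' m
  · rw [hr, coeff_expand_two_add_X_mul_even, if_neg (by omega), sub_zero, coeff_expand_two_add_X_mul_odd]
  · rw [hr, coeff_expand_two_add_X_mul_odd, if_pos (by omega), show 2 * r + 1 + 1 = 2 * (r + 1) by ring, coeff_expand_two_add_X_mul_even, show 2 * r + 1 + 2 = 2 * (r + 1) + 1 by ring,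
      coeff_expand_two_add_X_mul_odd, coeff_divX, coeff_sub, coeff_C_mul]

/-- **`Δ_{k+1}(p) = g₀ · Δ_k(p̃)` over any field** (`p = f(X²) + X g(X²)`, `g₀ ≠ 0`, `p̃` the Routh transform with `γ = f₀/g₀`; N210's (33)-step, which is stated over `ℝ`). [Gantmacher XV §6 (33); this file, §937] -/
theorem det_hurwitzSeqMatrix_succ_eq_mul_routh (k : ℕ) {f g : K[X]} (hg0 : g.coeff 0 ≠ 0) :
    (hurwitzSeqMatrix (k + 1) (expand K 2 f + Polynomial.X * expand K 2 g).coeff).det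
      = g.coeff 0 * (hurwitzSeqMatrix k (expand K 2 g + Polynomial.X * expand K 2 (f - C (f.coeff 0 / g.coeff 0) * g).divX).coeff).det := by
  have h1 : (expand K 2 f + Polynomial.X * expand K 2 g).coeff 1 = g.coeff 0 := by rw [show (1 : ℕ) = 2 * 0 + 1 by ring, coeff_expand_two_add_X_mul_odd]
  have h0 : (expand K 2 f + Polynomial.X * expand K 2 g).coeff 0 = f.coeff 0 / g.coeff 0 * (expand K 2 f + Polynomial.X * expand K 2 g).coeff 1 := by
    rw [h1, show (0 : ℕ) = 2 * 0 by ring, coeff_expand_two_add_X_mul_even, div_mul_cancel₀ _ hg0]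
  have hc : (fun m => (expand K 2 f + Polynomial.X * expand K 2 g).coeff (m + 1) - if m % 2 = 1 then f.coeff 0 / g.coeff 0 * (expand K 2 f + Polynomial.X * expand K 2 g).coeff (m + 2) else 0)
      = (expand K 2 g + Polynomial.X * expand K 2 (f - C (f.coeff 0 / g.coeff 0) * g).divX).coeff := funext fun m => (coeff_routh_transform_field f g _ m).symm
  rw [det_hurwitzSeqMatrix_succ_eq_mul k h0, h1, hc]

end General

/-! ## §938. The dictionary `det B_j(g, f) = Δ_{2j}`, `det B_{j+1}(f, Xg) = p_0 · Δ_{2j+1}` -/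

section Dictionary

variable {K : Type*} [Field K]

/-- **THE HURWITZ DETERMINANTS AS BEZOUTIAN MINORS (regular case): for `p = f(X²) + X·g(X²)` over a field, `det B_j(g, f) = Δ_{2j}(p)` provided `Δ_1, …, Δ_{2j} ≠ 0`, and `det B_{j+1}(f, X·g) =
p_0 · Δ_{2j+1}(p)` provided `Δ_1, …, Δ_{2j+1} ≠ 0`** (`Δ_k = det H_k(p_0, p_1, …)` the ascending Hurwitz determinants; leading principal minors of `B_m` are `det B_j`). Simultaneous induction on `j`
along Routh's step `(f, g) ↦ (g, g₁)`: `det B_{j+1}(f, Xg) = (f₀/g₀) g₀² det B_j(g₁, g)`, `B_j(g, f) = B_j(g, X g₁)`, `Δ_{k+1}(p) = g₀ Δ_k(p̃)`. [Gantmacher XV §6 + F–H Thm 5.55 (iii); this file, §938] -/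
theorem det_bezoutian_eq_det_hurwitzSeqMatrix : ∀ (j : ℕ) (f g : K[X]),
    ((∀ k, 1 ≤ k → k ≤ 2 * j → (hurwitzSeqMatrix k (expand K 2 f + Polynomial.X * expand K 2 g).coeff).det ≠ 0) →
        (bezoutian j g f).det = (hurwitzSeqMatrix (2 * j) (expand K 2 f + Polynomial.X * expand K 2 g).coeff).det)
      ∧ ((∀ k, 1 ≤ k → k ≤ 2 * j + 1 → (hurwitzSeqMatrix k (expand K 2 f + Polynomial.X * expand K 2 g).coeff).det ≠ 0) →
        (bezoutian (j + 1) f (Polynomial.X * g)).det = f.coeff 0 * (hurwitzSeqMatrix (2 * j + 1) (expand K 2 f + Polynomial.X * expand K 2 g).coeff).det) := by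
  intro j
  induction j with
  | zero =>
    intro f g
    refine ⟨fun _ => by rw [Matrix.det_fin_zero, Matrix.det_fin_zero], fun _ => ?_⟩
    have h1 : (hurwitzSeqMatrix (2 * 0 + 1) (expand K 2 f + Polynomial.X * expand K 2 g).coeff).det = (expand K 2 f + Polynomial.X * expand K 2 g).coeff 1 := det_hurwitzSeqMatrix_one _
    have h2 : (expand K 2 f + Polynomial.X * expand K 2 g).coeff 1 = g.coeff 0 := by simpa using coeff_expand_two_add_X_mul_odd f g 0
    rw [Matrix.det_fin_one, bezoutian_apply, Fin.val_zero, bezCoeff_swap, bezCoeff_X_mul_left_zero, h1, h2]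
    ring
  | succ j ih =>
    -- first `E_{j+1}` for every pair, then `O_{j+2}` from it
    have hE : ∀ f g : K[X], (∀ k, 1 ≤ k → k ≤ 2 * (j + 1) → (hurwitzSeqMatrix k (expand K 2 f + Polynomial.X * expand K 2 g).coeff).det ≠ 0) →
        (bezoutian (j + 1) g f).det = (hurwitzSeqMatrix (2 * (j + 1)) (expand K 2 f + Polynomial.X * expand K 2 g).coeff).det := by
      intro f g hreg
      have hg0 : g.coeff 0 ≠ 0 := by
        have := hreg 1 le_rfl (by omega)
        rwa [det_hurwitzSeqMatrix_one, show (1 : ℕ) = 2 * 0 + 1 by ring, coeff_expand_two_add_X_mul_odd] at this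
      have hfg := eq_C_mul_add_X_mul_divX_field (f := f) hg0
      -- `Δ_k(p̃) = Δ_{k+1}(p)/g₀ ≠ 0`
      have hreg' : ∀ k, 1 ≤ k → k ≤ 2 * j + 1 →
          (hurwitzSeqMatrix k (expand K 2 g + Polynomial.X * expand K 2 (f - C (f.coeff 0 / g.coeff 0) * g).divX).coeff).det ≠ 0 := fun k hk1 hk => by
        have := hreg (k + 1) (by omega) (by omega)
        rw [det_hurwitzSeqMatrix_succ_eq_mul_routh k hg0] at this
        exact right_ne_zero_of_mul this
      have hO := (ih g (f - C (f.coeff 0 / g.coeff 0) * g).divX).2 hreg'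
      rw [← bezoutian_routh_right (j + 1) hfg, hO]
      exact (det_hurwitzSeqMatrix_succ_eq_mul_routh (2 * j + 1) hg0).symm
    refine fun f g => ⟨hE f g, fun hreg => ?_⟩
    have hg0 : g.coeff 0 ≠ 0 := by
      have := hreg 1 le_rfl (by omega)
      rwa [det_hurwitzSeqMatrix_one, show (1 : ℕ) = 2 * 0 + 1 by ring, coeff_expand_two_add_X_mul_odd] at this
    have hfg := eq_C_mul_add_X_mul_divX_field (f := f) hg0
    have hreg' : ∀ k, 1 ≤ k → k ≤ 2 * (j + 1) →
        (hurwitzSeqMatrix k (expand K 2 g + Polynomial.X * expand K 2 (f - C (f.coeff 0 / g.coeff 0) * g).divX).coeff).det ≠ 0 := fun k hk1 hk => by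
      have := hreg (k + 1) (by omega) (by omega)
      rw [det_hurwitzSeqMatrix_succ_eq_mul_routh k hg0] at this
      exact right_ne_zero_of_mul this
    rw [det_bezoutian_X_mul_succ (j + 1) hfg hg0, hE g _ hreg', det_hurwitzSeqMatrix_succ_eq_mul_routh (2 * (j + 1)) hg0]
    field_simp

/-- **`det B_j(g, f) = Δ_{2j}(p)`** (regular to order `2j`). [this file, §938] -/
theorem det_bezoutian_even_odd_eq (j : ℕ) {f g : K[X]} (hreg : ∀ k, 1 ≤ k → k ≤ 2 * j → (hurwitzSeqMatrix k (expand K 2 f + Polynomial.X * expand K 2 g).coeff).det ≠ 0) :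
    (bezoutian j g f).det = (hurwitzSeqMatrix (2 * j) (expand K 2 f + Polynomial.X * expand K 2 g).coeff).det :=
  (det_bezoutian_eq_det_hurwitzSeqMatrix j f g).1 hreg

/-- **`det B_{j+1}(f, X·g) = p_0 · Δ_{2j+1}(p)`** (regular to order `2j + 1`). [this file, §938] -/
theorem det_bezoutian_X_mul_eq (j : ℕ) {f g : K[X]} (hreg : ∀ k, 1 ≤ k → k ≤ 2 * j + 1 → (hurwitzSeqMatrix k (expand K 2 f + Polynomial.X * expand K 2 g).coeff).det ≠ 0) :
    (bezoutian (j + 1) f (Polynomial.X * g)).det = f.coeff 0 * (hurwitzSeqMatrix (2 * j + 1) (expand K 2 f + Polynomial.X * expand K 2 g).coeff).det :=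
  (det_bezoutian_eq_det_hurwitzSeqMatrix j f g).2 hreg

end Dictionary

end Summit.Ventures.HSemireg.Wedge.HankelOuter
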